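import Literature.NumberTheory.EllipticCurves.ZpExtensionEisensteinBottomConjugationProofs
import HarnessLib

/-!
# The Iwasawa involution on the residual Eisenstein coefficient ring `A_{m,1} = Λ/(T^m + p, p)` — NAMED
# (`IwasawaAlgebra.EisensteinCoeff.invol₁`, a definition with body, and its named unfolding lemmas)

Topic `NumberTheory/EllipticCurves` (next to `IwasawaAlgebraInvolution`, `ZpExtensionScalarTwist` (`EisensteinCoeff`),
`ZpExtensionEisensteinBottomConjugationProofs`); namespace `Literature.NumberTheory.EllipticCurves.IwasawaAlgebra.EisensteinCoeff`.
D1 road of cell `pub/bsd-print-x9` (Howard's hypothesis H.5(b) for the Eisenstein specialisation at the places `v ∣ p`,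
the UNIFORM «`ι` on the characteristic-`p` level» road of `x9-p1-w3`, file plan F1–F7, brick (ι-1) consumed by F5).

The Iwasawa involution `ι : Λ → Λ`, `T ↦ (1 + T)⁻¹ − 1` (`IwasawaAlgebra.invol`, [Mazur–Tate–Teitelbaum, Ch. I §17];
inversion `γ ↦ γ⁻¹` on `ℤ_p⟦Γ⟧` read through `γ ↦ 1 + T`, [Washington §7.1/§13.2]) preserves the ideal `(T^m + p, p)`
(`invol_mem_of_mem`, file `ZpExtensionEisensteinBottomConjugationProofs`; it does NOT preserve `(T^m + p, p^j)` for `j ≥ 2`),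
hence DESCENDS to the residual coefficient ring `A_{m,1} = Λ/(T^m + p, p) = 𝔽_p[T]/(T^m)` of Howard's specialisation
`T_𝔮/pT_𝔮 = E[p] ⊗ A_{m,1}(ψ)` at the Eisenstein prime `𝔮 = (T^m + p)` [Howard 2004, §2.2 and proof of Thm. 2.2.10].
That file proves the existence of the induced ring endomorphism (`exists_ringHom_mk_eq_mk_invol`) and its properties
for ANY ring endomorphism `ι₁` with `ι₁ [G] = [ι G]` (hypothesis `hι`).  Consumers downstream (the `τ ⊗ ι`-comparison
`Θ₁ : Tw(W₁) → W₁` of the bottom Eisenstein level, F5 of the uniform road) want the map BY NAME; this file supplies it: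

* `invol₁ p m : EisensteinCoeff p m 1 →+* EisensteinCoeff p m 1` — THE induced involution (`Ideal.Quotient.lift`);
  `invol₁_mk` — `invol₁ [G] = [ι G]` (so every `hι`-lemma of `ZpExtensionEisensteinBottomConjugationProofs` applies as
  `… (invol₁_mk p m)`); `invol₁_involutive`, `invol₁_bijective`; `invol₁Equiv` — the same map as a `RingEquiv` (its own
  inverse), `invol₁Equiv_apply`, `invol₁Equiv_symm_apply`.
* the value `ψ(γ) = 1 + T`: `onePlusT_mul_invol₁_onePlusT`, `invol₁_onePlusT_mul_onePlusT'`, `invol₁_onePlusT_pow`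
  (`ι₁((1+T)^n) · (1+T)^n = 1`), `isUnit_onePlusT_one`, `invol₁_onePlusT_eq_inv` (`ι₁(1+T) = (1+T)⁻¹` on units);
* the uniformiser: `invol₁_mk_X_mul_onePlusT` (`ι₁[T] · (1+T) = −[T]`), `invol₁_mk_X_eq` (`ι₁[T] = u · [T]` with the unit
  `u = −(1+T)⁻¹`), `exists_unit_invol₁_mk_X`, `exists_unit_invol₁_mk_X_pow` (`ι₁[T]^r = u^r [T]^r`);
* `ι₁ ≡ id (mod [T])`: `invol₁_sub_self_mem` (`ι₁ x − x ∈ ([T])`), and `residueChar_invol₁_eq` (`ε ∘ ι₁ = ε`, named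
  instance of `residueChar_invol₁`).

DEFINITIONS WITH BODIES (`invol₁`, `invol₁Equiv`) + theorems; no named fact, no instance, no notation, no `sorry`.
Nothing is asserted about any curve; BSD is not proved by any of this.

References: [MazurTateTeitelbaum1986Invent] B. Mazur, J. Tate, J. Teitelbaum, Invent. Math. 84 (1986), Ch. I §17 (the
involution `ι`); [Washington1997] L. Washington, *Introduction to Cyclotomic Fields*, §7.1, §13.2; [Howard2004HeegnerKolyvagin]
B. Howard, Compositio Math. 140 (2004), §2.2 and proof of Thm. 2.2.10 (`𝔮 = T^m + p`), §3.2 (`T_𝔭` versus `T_{𝔭^ι}`).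
-/

noncomputable section

namespace Literature.NumberTheory.EllipticCurves.IwasawaAlgebra.EisensteinCoeff

variable (p : ℕ) [hp : Fact p.Prime] (m : ℕ)

/-! ## §1 The induced involution `ι₁` of `A_{m,1}`, named -/

/-- **The Iwasawa involution of the residual Eisenstein coefficient ring `A_{m,1} = Λ/(T^m + p, p)`**: the ring
endomorphism induced by `ι : T ↦ (1+T)⁻¹ − 1` of `Λ` (which preserves the ideal `(T^m + p, p)`, `invol_mem_of_mem`).
A definition with body (`Ideal.Quotient.lift`; the term of `exists_ringHom_mk_eq_mk_invol`).
[cite: MazurTateTeitelbaum1986Invent, Ch. I §17] [cite: Howard2004HeegnerKolyvagin, §2.2 and proof of Thm. 2.2.10 (𝔮 = T^m + p)] -/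
def invol₁ : EisensteinCoeff p m 1 →+* EisensteinCoeff p m 1 :=
  Ideal.Quotient.lift _ ((Ideal.Quotient.mk _).comp (invol p).toRingHom) fun _ ha ↦ by
    rw [RingHom.comp_apply, Ideal.Quotient.eq_zero_iff_mem]
    exact invol_mem_of_mem p m ha

/-- Defining property: `ι₁ [G] = [ι G]` — the hypothesis `hι` of the lemmas of `ZpExtensionEisensteinBottomConjugationProofs`,
so each of them applies to `invol₁` as `… (invol₁_mk p m)`. [cite: MazurTateTeitelbaum1986Invent, Ch. I §17] -/
theorem invol₁_mk (G : IwasawaAlgebra p) :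
    invol₁ p m (Ideal.Quotient.mk _ G) = Ideal.Quotient.mk _ (invol p G) :=
  Ideal.Quotient.lift_mk _ _ _

/-- `ι₁` is an involution: `ι₁ (ι₁ c) = c`. [cite: MazurTateTeitelbaum1986Invent, Ch. I §17] -/
theorem invol₁_involutive : Function.Involutive (invol₁ p m) :=
  fun c ↦ invol₁_invol₁ (invol₁_mk p m) c

/-- `ι₁` is bijective. [cite: MazurTateTeitelbaum1986Invent, Ch. I §17] -/
theorem invol₁_bijective : Function.Bijective (invol₁ p m) :=
  (invol₁_involutive p m).bijective

/-- **`ι₁` as a ring automorphism of `A_{m,1}`** (its own inverse). [cite: MazurTateTeitelbaum1986Invent, Ch. I §17] -/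
def invol₁Equiv : EisensteinCoeff p m 1 ≃+* EisensteinCoeff p m 1 :=
  RingEquiv.ofRingHom (invol₁ p m) (invol₁ p m) (RingHom.ext (invol₁_involutive p m)) (RingHom.ext (invol₁_involutive p m))

/-- `invol₁Equiv` is `invol₁` (unfolding). [cite: MazurTateTeitelbaum1986Invent, Ch. I §17] -/
@[simp] theorem invol₁Equiv_apply (c : EisensteinCoeff p m 1) : invol₁Equiv p m c = invol₁ p m c := rfl

/-- The inverse of `invol₁Equiv` is `invol₁` again (unfolding). [cite: MazurTateTeitelbaum1986Invent, Ch. I §17] -/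
@[simp] theorem invol₁Equiv_symm_apply (c : EisensteinCoeff p m 1) : (invol₁Equiv p m).symm c = invol₁ p m c := rfl

/-! ## §2 The value `ψ(γ) = 1 + T` -/

/-- `ι₁(1+T) · (1+T) = 1` (named instance of `invol₁_onePlusT_mul_onePlusT`). [cite: Howard2004HeegnerKolyvagin, §2.2 (Γ_K acts on Λ through γ ↦ 1 + T)] -/
theorem invol₁_onePlusT_mul_onePlusT' : invol₁ p m (onePlusT p m 1) * onePlusT p m 1 = 1 :=
  invol₁_onePlusT_mul_onePlusT (invol₁_mk p m)

/-- `(1+T) · ι₁(1+T) = 1`. [cite: Howard2004HeegnerKolyvagin, §2.2 (Γ_K acts on Λ through γ ↦ 1 + T)] -/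
theorem onePlusT_mul_invol₁_onePlusT : onePlusT p m 1 * invol₁ p m (onePlusT p m 1) = 1 := by
  rw [mul_comm]
  exact invol₁_onePlusT_mul_onePlusT' p m

/-- **`ι₁((1+T)^n) · (1+T)^n = 1`**: `ι₁` inverts every value `ψ(g) = (1+T)^{κ(g)}` of Howard's character.
[cite: Howard2004HeegnerKolyvagin, §2.2 (the character ψ)] [cite: MazurTateTeitelbaum1986Invent, Ch. I §17] -/
theorem invol₁_onePlusT_pow (n : ℕ) : invol₁ p m (onePlusT p m 1 ^ n) * onePlusT p m 1 ^ n = 1 := by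
  rw [RingHom.map_pow (invol₁ p m), ← mul_pow, invol₁_onePlusT_mul_onePlusT', one_pow]

/-- `(1+T)^n · ι₁((1+T)^n) = 1`. [cite: Howard2004HeegnerKolyvagin, §2.2 (the character ψ)] -/
theorem onePlusT_pow_mul_invol₁ (n : ℕ) : onePlusT p m 1 ^ n * invol₁ p m (onePlusT p m 1 ^ n) = 1 := by
  rw [mul_comm]
  exact invol₁_onePlusT_pow p m n

/-- `1 + T` is a unit of `A_{m,1}` (with inverse `ι₁(1+T)`). [cite: Howard2004HeegnerKolyvagin, §2.2] -/
theorem isUnit_onePlusT_one : IsUnit (onePlusT p m 1) :=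
  IsUnit.of_mul_eq_one _ (onePlusT_mul_invol₁_onePlusT p m)

/-- `ι₁(1+T)` is a unit of `A_{m,1}`. [cite: Howard2004HeegnerKolyvagin, §2.2] -/
theorem isUnit_invol₁_onePlusT : IsUnit (invol₁ p m (onePlusT p m 1)) :=
  IsUnit.of_mul_eq_one _ (invol₁_onePlusT_mul_onePlusT' p m)

/-- `ι₁(1+T) = (1+T)⁻¹` in the unit group of `A_{m,1}`. [cite: MazurTateTeitelbaum1986Invent, Ch. I §17] -/
theorem invol₁_onePlusT_eq_inv :
    invol₁ p m (onePlusT p m 1) = ↑((isUnit_onePlusT_one p m).unit⁻¹) := by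
  rw [← mul_one (↑((isUnit_onePlusT_one p m).unit⁻¹) : EisensteinCoeff p m 1), eq_comm,
    Units.inv_mul_eq_iff_eq_mul, IsUnit.unit_spec, onePlusT_mul_invol₁_onePlusT]

/-! ## §3 The uniformiser `[T]` -/

/-- **`ι₁[T] · (1 + [T]) = −[T]`** (`ι(T)(1+T) = −T` in `Λ`). [cite: MazurTateTeitelbaum1986Invent, Ch. I §17] -/
theorem invol₁_mk_X_mul_onePlusT :
    invol₁ p m (Ideal.Quotient.mk _ PowerSeries.X) * onePlusT p m 1 =
      -(Ideal.Quotient.mk _ PowerSeries.X : EisensteinCoeff p m 1) := by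
  rw [onePlusT_def, invol₁_mk, ← map_mul, invol_X_mul_one_add_X, map_neg]

/-- **`ι₁[T] = u · [T]`** with the unit `u = −(1+T)⁻¹` of `A_{m,1}`. [cite: MazurTateTeitelbaum1986Invent, Ch. I §17] -/
theorem invol₁_mk_X_eq :
    invol₁ p m (Ideal.Quotient.mk _ PowerSeries.X) =
      ↑(-(isUnit_onePlusT_one p m).unit⁻¹) * (Ideal.Quotient.mk _ PowerSeries.X : EisensteinCoeff p m 1) := by
  have h := invol₁_mk_X_mul_onePlusT p m
  rw [Units.val_neg, neg_mul, ← mul_neg, mul_comm, ← h, mul_assoc, IsUnit.mul_val_inv, mul_one]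

/-- `ι₁[T]` is a unit multiple of `[T]`. [cite: MazurTateTeitelbaum1986Invent, Ch. I §17] -/
theorem exists_unit_invol₁_mk_X :
    ∃ u : (EisensteinCoeff p m 1)ˣ,
      invol₁ p m (Ideal.Quotient.mk _ PowerSeries.X) = u * (Ideal.Quotient.mk _ PowerSeries.X : EisensteinCoeff p m 1) :=
  ⟨_, invol₁_mk_X_eq p m⟩

/-- `ι₁[T]^r = u^r · [T]^r` for the same unit `u`, every `r`. [cite: MazurTateTeitelbaum1986Invent, Ch. I §17] -/
theorem exists_unit_invol₁_mk_X_pow :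
    ∃ u : (EisensteinCoeff p m 1)ˣ, ∀ r : ℕ, invol₁ p m (Ideal.Quotient.mk _ PowerSeries.X) ^ r =
      (u : EisensteinCoeff p m 1) ^ r * (Ideal.Quotient.mk _ PowerSeries.X : EisensteinCoeff p m 1) ^ r :=
  ⟨_, fun r ↦ by rw [invol₁_mk_X_eq, mul_pow]⟩

/-- `ι₁([T]^r) = u^r · [T]^r`. [cite: MazurTateTeitelbaum1986Invent, Ch. I §17] -/
theorem invol₁_mk_X_pow (r : ℕ) :
    invol₁ p m ((Ideal.Quotient.mk _ PowerSeries.X : EisensteinCoeff p m 1) ^ r) =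
      (↑(-(isUnit_onePlusT_one p m).unit⁻¹) : EisensteinCoeff p m 1) ^ r *
        (Ideal.Quotient.mk _ PowerSeries.X : EisensteinCoeff p m 1) ^ r := by
  rw [RingHom.map_pow (invol₁ p m), invol₁_mk_X_eq, mul_pow]

/-! ## §4 `ι₁ ≡ id (mod [T])` -/

/-- **`ι₁ x − x ∈ ([T])`** for every `x ∈ A_{m,1}`: `ι` is the identity modulo the maximal ideal (`ι(G) − G` has constant
coefficient `0`). [cite: MazurTateTeitelbaum1986Invent, Ch. I §17] [cite: Washington1997, §7.1] -/
theorem invol₁_sub_self_mem (x : EisensteinCoeff p m 1) :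
    invol₁ p m x - x ∈ Ideal.span {(Ideal.Quotient.mk _ PowerSeries.X : EisensteinCoeff p m 1)} := by
  obtain ⟨G, rfl⟩ := Ideal.Quotient.mk_surjective x
  -- `ι T = T g`
  obtain ⟨g, hg⟩ : PowerSeries.X ∣ invol p PowerSeries.X := by
    rw [invol_X, PowerSeries.X_dvd_iff]
    exact constantCoeff_invSubOne p
  -- `G = T H + G(0)`
  set H : IwasawaAlgebra p := PowerSeries.mk (fun n ↦ PowerSeries.coeff (n + 1) G) with hH
  have hG : G = PowerSeries.X * H + PowerSeries.C (PowerSeries.constantCoeff G) := by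
    rw [hH, ← PowerSeries.eq_X_mul_shift_add_const]
  have hι : invol p G - G = PowerSeries.X * (g * invol p H - H) := by
    conv_lhs => rw [hG]
    rw [map_add, map_mul, hg, invol_C]
    ring
  rw [invol₁_mk, ← map_sub, hι, map_mul]
  exact Ideal.mul_mem_right _ _ (Ideal.mem_span_singleton_self _)

/-- `ι₁ x` and `x` have the same residue: `ε (ι₁ x) = ε x` (named instance of `residueChar_invol₁`).
[cite: Howard2004HeegnerKolyvagin, proof of Prop. 2.1.3 (S_𝔭/𝔪)] [cite: MazurTateTeitelbaum1986Invent, Ch. I §17] -/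
theorem residueChar_invol₁_eq (hm : 1 ≤ m) (x : EisensteinCoeff p m 1) :
    residueChar p hm (le_refl 1) (invol₁ p m x) = residueChar p hm (le_refl 1) x :=
  residueChar_invol₁ (invol₁_mk p m) hm x

/-- `ι₁[T]^{m-1} = (−1)^{m-1} [T]^{m-1}` (named instance of `invol₁_mk_X_pow_pred`).
[cite: MazurTateTeitelbaum1986Invent, Ch. I §17] [cite: Howard2004HeegnerKolyvagin, proof of Thm. 2.2.10] -/
theorem invol₁_mk_X_pow_pred_eq (hm : 1 ≤ m) :
    invol₁ p m (Ideal.Quotient.mk _ PowerSeries.X) ^ (m - 1) =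
      (-1) ^ (m - 1) * (Ideal.Quotient.mk _ PowerSeries.X : EisensteinCoeff p m 1) ^ (m - 1) :=
  invol₁_mk_X_pow_pred (invol₁_mk p m) hm

/-- From `(1+T)^e · (1+T)^{e'} = 1`: `(ι₁(1+T))^{e'} = (1+T)^e` (named instance of `invol₁_onePlusT_pow_eq`; opposite
exponents of an anticyclotomic character match under `ι₁`). [cite: Howard2004HeegnerKolyvagin, §2.2 (anticyclotomic character)] -/
theorem invol₁_onePlusT_pow_eq' {e e' : ℕ} (h : onePlusT p m 1 ^ e * onePlusT p m 1 ^ e' = 1) :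
    invol₁ p m (onePlusT p m 1) ^ e' = onePlusT p m 1 ^ e :=
  invol₁_onePlusT_pow_eq (invol₁_mk p m) h

end Literature.NumberTheory.EllipticCurves.IwasawaAlgebra.EisensteinCoeff

end
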